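import Mathlib
import Summits.NavierStokesRegularity.NavierStokesRegularity.Theorems.TaoLadderRungTwoFlatNearBehindStep
import Summits.NavierStokesRegularity.NavierStokesRegularity.Theorems.TaoLadderRungTwoFlatHopAprioriGraded
import HarnessLib

/-!
# The NEAR and BEHIND per-hop obligations of the R54 tube at the choice rule with budgets at an anchor-scale LOWER BOUND
  (theory-1 g47 TRAP #18 «ratio floor» cure, second option) (helper for the K_A♭ parent item stmt-NavierStokesRegularity-22987
  `FlatGapCertificatesV2`, child 2A `GradedAdiabaticWakeA` of route TaoLadderRungTwoFlat; cell harvest/h2-tao-ladder, p1 g23; LADDER §59)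

`…NearBehindStep(Core)` discharge the near/behind budgets at the format floor `((1+ε₀)^{−θ₀})²` at EVERY hop (the only lower
bound the clamped ratio carries by construction), which theory-1 g47 shows is the §50 rule only for the early clamped hops and
costs the ε₀-window otherwise (TRAP #18). This module re-issues the composed step with the budgets checked at a schedule ratio
`a_lo` together with the hypothesis `a_lo ≤ clampedRatio` at good times (a CORE/anchor output, e.g. `x(z)·R_ref(1 − C_r δ(n))`);
the floor version is the instance `a_lo := (1+ε₀)^{−θ₀}` by `HopTube.floor_le_clampedRatio`.

* `tubeStepNearBehindR54_of_schedule_alo`.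

HONEST FRAMING: bookkeeping over the cell's typed induction frame and p1's zone lemmas (MODEL lattice, graded mirror table on
`S♭`, `m = 2`); every remaining input is a HYPOTHESIS; nothing certified; no item closed; nothing about the Navier–Stokes equations.
-/

noncomputable section

-- the sub-problem namespace repeats the summit name by design (D-0017)
set_option linter.dupNamespace false

namespace Summit.NavierStokesRegularity.NavierStokesRegularity.Theorems.HopTube

open Set Finset Literature.Analysis.FluidPDE Literature.Analysis.FluidPDE.TaoCascade MirrorPulse RenormFrame QuadPolar
  GappedFrontRobustOn

section Step

variable {ε ε₀ : ℝ}

/-- **`TubeStepNear` ∧ `TubeStepBehind` OF THE R54 TUBE AT THE CHOICE RULE, budgets at an ANCHOR-SCALE LOWER BOUND `a_lo`**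
(theory-1 g47 TRAP #18 cure, second option): as `tubeStepNearBehindR54_of_schedule'` but the two budgets are discharged at a
schedule ratio `a_lo ≤ clampedRatio` (hypothesis `halo`, a CORE/anchor output — e.g. `x(z)·R_ref·(1 − C_r δ(n))`) instead of the
format floor `(1+ε₀)^{−θ₀}` (recovered with `a_lo :=` the floor and `floor_le_clampedRatio`). See the module docstring.
[cite: Tao2016AveragedNS, §4 (4.1), (4.3), (4.5), (4.8), §6.3–6.4 Props. 6.4–6.5 (statement shape of the inductive step); route TaoLadderRungTwoFlat, `HopTube.TubeStepNearWith`/`TubeStepBehindWith` for `behindR54` (cell LADDER §50, §54–§58)] -/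
theorem tubeStepNearBehindR54_of_schedule_alo (P : TubeSchedule) {θ' : ℝ} {Wb : ℕ → ℝ} {i₀ : Fin 2}
    {X₀ : Fin 2 → ℝ} {w : ℤ → ℝ} {r θ₀ c₀ t₀ : ℝ} {ζ : ℕ → Fin 2 → ℤ → ℝ} {ustar : Fin 2 → ℤ → ℝ}
    {good : ℕ → (Fin 2 → ℤ → ℝ → ℝ) → ℝ → Prop} {n : ℕ}
    {cW : ℝ} {W₀ : Fin 2 → ℤ → ℝ} {W FW : Fin 2 → ℤ → ℝ → ℝ}
    (hWflow : PseudoFlowOnShift shiftSetFlat cW ε₀ (mirrorTable ε ε) 0 0 W₀ (fun i k => (1 / 2) * W₀ i k ^ 2)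
      (fun _ _ => 0) W FW) (hcW : c₀ ≤ cW)
    (hε : 0 ≤ ε) (hε₀ : 0 < ε₀) (hn : P.N₀ < n) (hDK : P.K + 1 ≤ P.D) (hθV : 0 ≤ P.θV)
    (hθ : 0 < θ') (hθ5 : θ' ≤ 5 * Real.log (1 + ε₀)) (hw1 : ∀ k, 1 ≤ w k) (hr0 : 0 ≤ r)
    (hAstar : 0 < P.Astar) {ωK MuK : ℝ} (hωK : 0 < ωK)
    (hωKle : ∀ i, ωK ≤ MirrorPulse.geomGauge P.g P.b i (-(P.K : ℤ))) (hMuK : ∀ i, |ustar i (-(P.K : ℤ))| ≤ MuK)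
    (hWbn : 0 ≤ Wb n) (hWbn1 : 0 ≤ Wb (n + 1)) (hvn1 : 0 ≤ P.v (n + 1))
    {tlo : ℝ} (htlo : 0 < tlo)
    (hex : ∀ z S₀ τ S F, HopPremiseWith P (behindR54 P θ' Wb) shiftSetFlat ε₀ i₀ (mirrorTable ε ε) X₀ w r c₀ ζ
      ustar n z S₀ τ S F → ∃ t, good n S t)
    (hwin : ∀ z S₀ τ S F, HopPremiseWith P (behindR54 P θ' Wb) shiftSetFlat ε₀ i₀ (mirrorTable ε ε) X₀ w r c₀ ζ
      ustar n z S₀ τ S F → ∀ t, good n S t → tlo ≤ t ∧ t ≤ c₀)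
    {alo : ℝ} (halo0 : 0 ≤ alo)
    (halo : ∀ z S₀ τ S F, HopPremiseWith P (behindR54 P θ' Wb) shiftSetFlat ε₀ i₀ (mirrorTable ε ε) X₀ w r c₀ ζ
      ustar n z S₀ τ S F → ∀ t, good n S t → alo ≤ clampedRatio P i₀ ε₀ θ₀ t S)
    {Aeff A A₁ M M₁ μN μB VbarN VbarB EW RT V₀N V₀B : ℝ} {rc : ℝ → ℝ} (hAeff : 0 < Aeff) (hM0 : 0 ≤ M)
    (hM : ∀ s ∈ Icc 0 c₀, ∀ i, ∀ m ∈ Finset.Icc (-(P.D : ℤ)) (1 - (P.K : ℤ)), |W i m s| ≤ M)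
    (hM₁ : ∀ s ∈ Icc 0 c₀, |W 1 (-(P.K : ℤ)) s| ≤ M₁)
    (hEW : ∀ z, InTubeWith P (behindR54 P θ' Wb) i₀ X₀ w r ζ ustar n z →
      coMovingEnergyOn (Finset.Icc (1 - (P.D : ℤ)) (-(P.K : ℤ))) P.θV (-(P.K : ℝ))
        (fun i k _ => anchorScale P i₀ z * ustar i k - W₀ i k) 0 ≤ EW)
    -- three-zone loop data (gauge, reference sup, initial gauge distance, core levels) replacing the core bottom input
    {ω : Fin 2 → ℤ → ℝ} {Λ Cω MtW Mt Mc B : ℝ}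
    (hωreg : IsWindowRegular (fun i k => ω i k / clockW ε₀ k) Λ) (hCω0 : 0 ≤ Cω)
    (hCω : ∀ (i : Fin 2) (k : ℤ), 1 - (P.K : ℤ) ≤ k → clockW ε₀ k ≤ Cω * ω i k)
    (hωKle' : ∀ i, ωK ≤ ω i (1 - (P.K : ℤ)))
    (hMtW : 0 ≤ MtW) (hWb : ∀ (i : Fin 2) (k : ℤ), ∀ s ∈ Icc 0 c₀, clockW ε₀ k * |W i k s| ≤ MtW)
    (hBpos : 0 < B)
    (hBof : ∀ z S₀ τ S F, HopPremiseWith P (behindR54 P θ' Wb) shiftSetFlat ε₀ i₀ (mirrorTable ε ε) X₀ w r c₀ ζ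
      ustar n z S₀ τ S F → ∀ (i : Fin 2) (k : ℤ), ω i k * |S₀ i k - W₀ i k| ≤ B)
    (hMc : 0 < Mc) (hMtdef : Mt = max (max Mc ((1 + ε₀) ^ ((5 : ℝ) / 2) * Aeff)) MtW)
    -- the CORE input as a function of the hop time: `r_c(t) = 2·B·e^{2‖α̃‖₁M̃Λt}/ω_K + M`
    (hrcdef : ∀ t, rc t = 2 * (B * Real.exp (2 * tableAbsSum shiftSetFlat (renormTable ε₀ (mirrorTable ε ε)) * Mt * Λ * t))
      / ωK + M)
    (hcloseC : ∀ t ∈ Icc tlo c₀,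
      MtW + Cω * (B * Real.exp (2 * tableAbsSum shiftSetFlat (renormTable ε₀ (mirrorTable ε ε)) * Mt * Λ * t)) < Mc)
    (hRT : ∀ z S₀ τ S F, HopPremiseWith P (behindR54 P θ' Wb) shiftSetFlat ε₀ i₀ (mirrorTable ε ε) X₀ w r c₀ ζ
      ustar n z S₀ τ S F → ∀ t, good n S t →
        ∑ k ∈ Finset.Icc (-(P.D : ℤ)) (-(P.K : ℤ) - 1), Real.exp (P.θV * ((k : ℝ) + P.K)) *
          ∑ i : Fin 2, (W i (1 + k) t - |S i₀ 1 t| / P.Astar * ustar i k) ^ 2 / 2 ≤ RT)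
    (hAdef : A = Real.sqrt (2 * VbarB) * Real.exp (θ' / 2) * Real.exp (θ' * ((P.D : ℝ) - P.K) / 2) + M)
    (hA₁def : A₁ = M₁ + Real.sqrt (2 * VbarN) * Real.exp (P.θV / 2))
    (hrA : ∀ t ∈ Icc tlo c₀, rc t ≤ A) (hA₀le : ∀ t ∈ Icc tlo c₀, M + rc t ≤ Aeff)
    (hV₀Ndef : V₀N = (Real.sqrt (P.v n + (P.δ n / ωK) ^ 2) + Real.sqrt P.D * r + Real.sqrt EW) ^ 2)
    (hV₀Bdef : V₀B = (Real.sqrt (Wb n + (MuK + P.δ n / ωK) ^ 2) + r / Real.sqrt (1 - Real.exp (-θ'))) ^ 2)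
    (hμN : 0 < μN)
    (hμNle : μN ≤ (1 / c₀) * P.θV - 2 * (1 + ε) * 1 * (A * Real.sinh (P.θV / 2) + M * (3 + Real.exp P.θV)))
    (hμB : 0 < μB) (hμBle : μB ≤ (1 / c₀) * θ' - 2 * (1 + ε) * Aeff * Real.sinh (θ' / 2))
    (hlevN : ∀ t ∈ Icc tlo c₀, V₀N + (Real.exp (P.θV * ((1 : ℝ) - P.D + P.K)) * ((1 + ε) * 1 * A ^ 2 * (A + M))
      + (1 + ε) * 1 * rc t * (A ^ 2 + M * rc t)) * t < VbarN)
    (hlevB : ∀ t ∈ Icc tlo c₀, V₀B + A₁ * (M + rc t) * (A₁ + ε * (M + rc t)) * t < VbarB)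
    (hclose : Real.sqrt (2 * VbarB) * Real.exp (θ' / 2) ≤ Aeff)
    (hbudgetN : ∀ t ∈ Icc tlo c₀, (Real.sqrt (Real.exp (-μN * t) * V₀N
      + (Real.exp (P.θV * ((1 : ℝ) - P.D + P.K)) * ((1 + ε) * 1 * A ^ 2 * (A + M))
        + (1 + ε) * 1 * rc t * (A ^ 2 + M * rc t)) * (1 - Real.exp (-μN * t)) / μN)
      + Real.sqrt RT) ^ 2 ≤ alo ^ 2 * P.v (n + 1))
    (hbudgetB : ∀ t ∈ Icc tlo c₀, Real.exp (-μB * t) * V₀B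
      + A₁ * (M + rc t) * (A₁ + ε * (M + rc t)) * (1 - Real.exp (-μB * t)) / μB
      ≤ alo ^ 2 * Wb (n + 1)) :
    TubeStepNearWith P (behindR54 P θ' Wb) (choiceRule P i₀ ε₀ θ₀ t₀ good) shiftSetFlat ε₀ i₀ (mirrorTable ε ε)
        X₀ w r c₀ ζ ustar n ∧
      TubeStepBehindWith P (behindR54 P θ' Wb) (choiceRule P i₀ ε₀ θ₀ t₀ good) shiftSetFlat ε₀ i₀ (mirrorTable ε ε)
        X₀ w r c₀ ζ ustar n := by
  have hε₀' : (-1 : ℝ) < ε₀ := by linarith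
  have hrc0 : ∀ t, 0 ≤ rc t := fun t => by rw [hrcdef]; positivity
  -- the two landing clauses at every good time of every premise
  have key : ∀ z S₀ τ S F, HopPremiseWith P (behindR54 P θ' Wb) shiftSetFlat ε₀ i₀ (mirrorTable ε ε) X₀ w r c₀ ζ
      ustar n z S₀ τ S F → ∀ t, good n S t →
        NearClause P i₀ ustar (n + 1) (recentre S t (clampedRatio P i₀ ε₀ θ₀ t S)) ∧
        R54.BehindEnergyClause P.K θ' (Wb (n + 1)) (recentre S t (clampedRatio P i₀ ε₀ θ₀ t S)) := by
    intro z S₀ τf S F hprem t hgood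
    obtain ⟨htlo_t, htc₀⟩ := hwin z S₀ τf S F hprem t hgood
    have htpos : 0 < t := htlo.trans_le htlo_t
    have hRT_t := hRT z S₀ τf S F hprem t hgood
    have halo_t := halo z S₀ τf S F hprem t hgood
    have hB_t := hBof z S₀ τf S F hprem
    obtain ⟨hz, hkick, hc₀τ, hflow⟩ := hprem
    -- the clauses of `H(n)` (tube phase)
    have hzW : InTubeWith P (behindR54 P θ' Wb) i₀ X₀ w r ζ ustar n z := hz
    have h0 : n ≠ 0 := by omega
    have h1 : ¬ n ≤ P.N₀ := by omega
    simp only [InTubeWith, h0, if_false, h1] at hz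
    obtain ⟨hanch, hcoreCl, hnearCl, hbeh, -⟩ := hz
    -- restrict both flows to `[0, t]`
    have hS' := pseudoFlowOnShift_mono hflow htpos (htc₀.trans hc₀τ)
    have hW' := pseudoFlowOnShift_mono hWflow htpos (htc₀.trans hcW)
    -- the kick, everywhere (weights `≥ 1`)
    have hkick' : ∀ i k, |S₀ i k - z i k| ≤ r := by
      intro i k
      calc |S₀ i k - z i k| = 1 * |S₀ i k - z i k| := (one_mul _).symm
        _ ≤ w k * |S₀ i k - z i k| := mul_le_mul_of_nonneg_right (hw1 k) (abs_nonneg _)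
        _ ≤ r := hkick i k
    -- the ratio of the choice rule
    have ha : 0 < clampedRatio P i₀ ε₀ θ₀ t S := clampedRatio_pos P i₀ hε₀' θ₀ t S
    have hfa2 : alo ^ 2 ≤ clampedRatio P i₀ ε₀ θ₀ t S ^ 2 := pow_le_pow_left₀ halo0 halo_t 2
    -- the STARTS from `H(n)`
    have hstartN : coMovingEnergyOn (Finset.Icc (1 - (P.D : ℤ)) (-(P.K : ℤ))) P.θV (-(P.K : ℝ)) (S - W) 0 ≤ V₀N := by
      have h := sqrt_initial_coMovingEnergyOn_le_additive P hflow.init_S hWflow.init_S hθV hDK hnearCl hcoreCl hωK hωKle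
        (fun i k _ => hkick' i k) hr0 (hEW z hzW)
      have hnn : 0 ≤ coMovingEnergyOn (Finset.Icc (1 - (P.D : ℤ)) (-(P.K : ℤ))) P.θV (-(P.K : ℝ)) (S - W) 0 :=
        coMovingEnergyOn_nonneg _ _ _ _ _
      rw [hV₀Ndef]
      calc coMovingEnergyOn (Finset.Icc (1 - (P.D : ℤ)) (-(P.K : ℤ))) P.θV (-(P.K : ℝ)) (S - W) 0
          = Real.sqrt (coMovingEnergyOn (Finset.Icc (1 - (P.D : ℤ)) (-(P.K : ℤ))) P.θV (-(P.K : ℝ)) (S - W) 0) ^ 2 :=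
            (Real.sq_sqrt hnn).symm
        _ ≤ _ := pow_le_pow_left₀ (Real.sqrt_nonneg _) h 2
    have haK : ∀ i, |z i (-(P.K : ℤ))| ≤ MuK + P.δ n / ωK := fun i =>
      abs_windowBottom_le_of_clauses P hAstar hanch hcoreCl hωK hωKle hMuK i
    have hstartB : ∀ L : ℕ, coMovingEnergyOn (Finset.Icc (1 - (P.K : ℤ) - L) (-(P.K : ℤ))) θ' (-(P.K : ℝ)) S 0
        ≤ V₀B := by
      intro L
      rw [hV₀Bdef]
      exact R54.initial_blockEnergy_le_additive hflow.init_S hθ hbeh.1 hWbn haK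
        (fun i k hk => hkick' i k) hr0
    -- rates at this `t ≤ c₀`
    have h1t : 1 / c₀ ≤ 1 / t := one_div_le_one_div_of_le htpos htc₀
    have hμNle' : μN ≤ (1 / t) * P.θV - 2 * (1 + ε) * 1 * (A * Real.sinh (P.θV / 2) + M * (3 + Real.exp P.θV)) := by
      have h2 := mul_le_mul_of_nonneg_right h1t hθV
      linarith only [h2, hμNle]
    have hμBle' : μB ≤ (1 / t) * θ' - 2 * (1 + ε) * Aeff * Real.sinh (θ' / 2) := by
      have h2 := mul_le_mul_of_nonneg_right h1t hθ.le
      linarith only [h2, hμBle]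
    have hστ : (1 / t) * t = 1 := by rw [one_div, inv_mul_cancel₀ (ne_of_gt htpos)]
    have htI : t ∈ Icc tlo c₀ := ⟨htlo_t, htc₀⟩
    -- budgets at the clamped ratio
    have hbN' := (hbudgetN t htI).trans (mul_le_mul_of_nonneg_right hfa2 hvn1)
    have hbB' := (hbudgetB t htI).trans (mul_le_mul_of_nonneg_right hfa2 hWbn1)
    -- the CORE bottom input from the three-zone loop on `[0, t]`
    have hrate0 : 0 ≤ 2 * tableAbsSum shiftSetFlat (renormTable ε₀ (mirrorTable ε ε)) * Mt * Λ := by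
      have hT0 : 0 ≤ tableAbsSum shiftSetFlat (renormTable ε₀ (mirrorTable ε ε)) := tableAbsSum_nonneg _ _
      have hΛ0 : 0 ≤ Λ := by linarith [hωreg.2.1]
      have hMt0 : 0 ≤ Mt := by rw [hMtdef]; exact hMtW.trans (le_max_right _ _)
      positivity
    have hrct := hrcdef t
    obtain ⟨hdev, -, -, -⟩ := R54.hop_apriori_graded (σ := 1 / t) (τ₁ := t) (r := rc t) (A₀ := M + rc t)
      (Bbar := B * Real.exp (2 * tableAbsSum shiftSetFlat (renormTable ε₀ (mirrorTable ε ε)) * Mt * Λ * t))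
      hW' hS' hε hε₀ hDK hθV hθ.le hθ5 hAeff htpos le_rfl hστ
      hωreg hCω0 hCω hωK hωKle' hMtW (fun i k s hs => hWb i k s ⟨hs.1, hs.2.trans htc₀⟩) hM0
      (fun s hs => hM s ⟨hs.1, hs.2.trans htc₀⟩) (fun s hs => hM₁ s ⟨hs.1, hs.2.trans htc₀⟩)
      hBpos hB_t hMc hMtdef rfl hrct hAdef rfl hA₁def (hrA t htI) (hA₀le t htI) hstartN hstartB hμN hμNle' hμB hμBle'
      (hlevN t htI) (hlevB t htI) hclose (hcloseC t htI)
    have hcore_t : ∀ s ∈ Icc 0 t, ∀ i, |(S - W) i (1 - (P.K : ℤ)) s| ≤ rc t := by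
      intro s hs i
      have h1 := hdev s hs i (1 - (P.K : ℤ))
      have h2 : ω i (1 - (P.K : ℤ)) * |S i (1 - (P.K : ℤ)) s - W i (1 - (P.K : ℤ)) s|
          ≤ B * Real.exp (2 * tableAbsSum shiftSetFlat (renormTable ε₀ (mirrorTable ε ε)) * Mt * Λ * t) := by
        refine h1.trans ?_
        exact mul_le_mul_of_nonneg_left (Real.exp_le_exp.mpr (mul_le_mul_of_nonneg_left hs.2 hrate0)) hBpos.le
      have hBt0 : 0 ≤ B * Real.exp (2 * tableAbsSum shiftSetFlat (renormTable ε₀ (mirrorTable ε ε)) * Mt * Λ * t) := by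
        positivity
      have h3 : |S i (1 - (P.K : ℤ)) s - W i (1 - (P.K : ℤ)) s|
          ≤ B * Real.exp (2 * tableAbsSum shiftSetFlat (renormTable ε₀ (mirrorTable ε ε)) * Mt * Λ * t) / ωK := by
        rw [le_div_iff₀ hωK]
        calc |S i (1 - (P.K : ℤ)) s - W i (1 - (P.K : ℤ)) s| * ωK
            ≤ |S i (1 - (P.K : ℤ)) s - W i (1 - (P.K : ℤ)) s| * ω i (1 - (P.K : ℤ)) :=
              mul_le_mul_of_nonneg_left (hωKle' i) (abs_nonneg _)
          _ ≤ _ := by rw [mul_comm]; exact h2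
      have h4 : B * Real.exp (2 * tableAbsSum shiftSetFlat (renormTable ε₀ (mirrorTable ε ε)) * Mt * Λ * t) / ωK
          ≤ rc t := by
        rw [hrct]
        have h5 : 0 ≤ B * Real.exp (2 * tableAbsSum shiftSetFlat (renormTable ε₀ (mirrorTable ε ε)) * Mt * Λ * t) / ωK :=
          div_nonneg hBt0 hωK.le
        have e : 2 * (B * Real.exp (2 * tableAbsSum shiftSetFlat (renormTable ε₀ (mirrorTable ε ε)) * Mt * Λ * t)) / ωK
            = 2 * (B * Real.exp (2 * tableAbsSum shiftSetFlat (renormTable ε₀ (mirrorTable ε ε)) * Mt * Λ * t) / ωK) := by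
          ring
        rw [e]; linarith
      simpa only [Pi.sub_apply] using h3.trans h4
    -- the joint hop
    exact R54.near_behind_hop_of_schedule_sharp P hW' hS' hε hε₀ hDK hθV hθ.le hθ5 hAeff htpos le_rfl hστ ha hM0
      (fun s hs => hM s ⟨hs.1, hs.2.trans htc₀⟩) (fun s hs => hM₁ s ⟨hs.1, hs.2.trans htc₀⟩) hcore_t (hrc0 t)
      hAdef rfl hA₁def (hrA t htI) (hA₀le t htI) hstartN hstartB hμN hμNle' hμB hμBle' (hlevN t htI) (hlevB t htI)
      hclose hRT_t hbN' hbB'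
  have hwin' : ∀ z S₀ τ S F, HopPremiseWith P (behindR54 P θ' Wb) shiftSetFlat ε₀ i₀ (mirrorTable ε ε) X₀ w r c₀ ζ
      ustar n z S₀ τ S F → ∀ t, good n S t → 0 < t ∧ t ≤ c₀ := fun z S₀ τ S F h t ht =>
    ⟨htlo.trans_le (hwin z S₀ τ S F h t ht).1, (hwin z S₀ τ S F h t ht).2⟩
  exact ⟨tubeStepNearWith_of_good hex fun z S₀ τ S F h t ht => (key z S₀ τ S F h t ht).1,
    tubeStepBehindR54_of_good hε₀' hex hwin' fun z S₀ τ S F h t ht => (key z S₀ τ S F h t ht).2⟩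

end Step

end Summit.NavierStokesRegularity.NavierStokesRegularity.Theorems.HopTube

end
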